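import Mathlib
import Summits.Ventures.HodgeRepro.Tier4.Common.Geometry

/-!
# Tier4/Common/HeckeGroup — the Hecke translates as a GROUP acting on forms by pull-back, the group algebra
`ℂ[H]` as the Hecke algebra, and «a non-zero pairing against a Hecke-ALGEBRA element is a non-zero pairing
against ONE translate» (the single-translate form of (P) from the algebra form)

Blind re-derivation cell `pub-hodge-repro`, Tier 4 (README §9–§10), seat t4-typer-2 (gen 0).  Target tree path
`lean/Summits/Ventures/HodgeRepro/Tier4/Common/HeckeGroup.lean`.  Imports `Tier4/Common/Geometry.lean`
(t4-typer-1: `FormAlgebra`, `HeckeAction`, `Witness`, `Witness.P`).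

WHY.  The sentence (P) (route/TIER3.md §1 item 3) chooses ONE Hecke translate per Albanese component: `f` is «the
product of Hecke-translated Albanese maps», `f^*ω_j = T_{γ_j}^* ω_j`.  The spectral / isolation arguments of the
route (night-2's (S3) `HeckeIsolation`; Tier 3's `HodgeRepro.T3P1.exists_smul_pairing_ne_zero`, Jacobson density)
produce instead an element `r` of the HECKE ALGEBRA with `⟨r • (ω_0 ∧ ω_1), ω_2 ∧ ω_3⟩ ≠ 0`.  When the translates
form a GROUP `H` acting on forms by pull-back (the rational points of the unitary group acting on the ball; the
sealed statement (c) `HeckeTranslateWedge` of `Statements.lean` quantifies over a dense subgroup `Δ ≤ U(2,1)` with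
`γ^*F = z ↦ J_γ(z)ᵀ F(γ z)`), a pull-back respects wedges, `g^*(ω_0 ∧ ω_1) = g^*ω_0 ∧ g^*ω_1`, and an element of
the group algebra `ℂ[H]` is a finite combination `Σ c_g g`; so `⟨Σ c_g g^*(ω_0 ∧ ω_1), β⟩ = Σ c_g ⟨g^*ω_0 ∧ g^*ω_1,
β⟩ ≠ 0` forces ONE `g` with `⟨g^*ω_0 ∧ g^*ω_1, β⟩ ≠ 0`.  That is the lemma `exists_pairing_ne_zero_of_algebra` and
its corollary **`P_of_algebra_pairing`**: (P) follows from a non-zero pairing of algebra translates of the two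
wedges.  Linear algebra only (Mathlib `Representation.asAlgebraHom`, `MonoidAlgebra.lift_apply`).

WHAT IS TYPED.  `HeckeGroup W` (over a group structure `[Group W.Hecke]` on the witness's translate type): the
action `T ↦ T^*` is a ℂ-linear representation `ρ : H →* (Form →ₗ[ℂ] Form)` (`Representation ℂ H Form`), `W.translate g = ρ g`, `W.one = 1`, and
the pull-back is wedge-compatible.  Every field is a parameter; nothing here says anything about the status of the
Hodge conjecture for CM abelian varieties, which is NOT proved (HC_CM is NOT proved by anyone in this repository).
-/

set_option autoImplicit false

noncomputable section

namespace Summit.Ventures.HodgeRepro.Tier4.Common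

open MonoidAlgebra

/-- **The Hecke translates as a group acting by pull-back**: the correspondences of the witness form a group `H`
(intended: the rational points of the unitary group acting on the ball), the action on forms is a ℂ-linear
representation with `W.translate g = ρ g` and `W.one = 1`, and the pull-back along `g` respects the wedge product,
`g^*(α ∧ β) = g^*α ∧ g^*β`. -/
structure HeckeGroup {Form : Type} [AddCommGroup Form] [Module ℂ Form] {A : FormAlgebra Form} (W : Witness A)
    [Group W.Hecke] where
  /-- the representation `g ↦ g^*` on the forms -/
  rep : Representation ℂ W.Hecke Form
  /-- the witness's translate is the representation -/
  translate_eq : ∀ (g : W.Hecke) (α : Form), W.translate g α = rep g α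
  /-- the witness's identity correspondence is the group identity -/
  one_eq : W.one = 1
  /-- pull-back respects the wedge -/
  wedge_comm : ∀ (g : W.Hecke) (α β : Form), rep g (A.wedge α β) = A.wedge (rep g α) (rep g β)

namespace HeckeGroup

variable {Form : Type} [AddCommGroup Form] [Module ℂ Form] {A : FormAlgebra Form} {W : Witness A}
  [Group W.Hecke] (G : HeckeGroup W)

/-- The Hecke algebra of the group: the group algebra `ℂ[H]`, acting on forms through `ρ`
(`Representation.asAlgebraHom`): `(Σ c_g g) • α = Σ c_g g^*α`. -/
def algebraAction (x : MonoidAlgebra ℂ W.Hecke) (α : Form) : Form := G.rep.asAlgebraHom x α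

/-- A single translate, as an element of the Hecke algebra, acts as the translate. -/
theorem algebraAction_single (g : W.Hecke) (c : ℂ) (α : Form) :
    G.algebraAction (single g c) α = c • W.translate g α := by
  simp only [algebraAction, Representation.asAlgebraHom_single, LinearMap.smul_apply, G.translate_eq]

/-- The algebra action, expanded: `(Σ c_g g) • α = Σ_{g ∈ supp} c_g • g^*α`. -/
theorem algebraAction_eq_sum (x : MonoidAlgebra ℂ W.Hecke) (α : Form) :
    G.algebraAction x α = ∑ g ∈ x.coeff.support, x.coeff g • W.translate g α := by
  simp only [algebraAction, Representation.asAlgebraHom_def, MonoidAlgebra.lift_apply, Finsupp.sum,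
    LinearMap.sum_apply, LinearMap.smul_apply, G.translate_eq]

/-- **One translate suffices**: if a Hecke-ALGEBRA translate of `α` pairs non-trivially with `β`, some single
translate of `α` does. -/
theorem exists_pairing_ne_zero_of_algebra (x : MonoidAlgebra ℂ W.Hecke) (α β : Form)
    (h : A.hodge (G.algebraAction x α) β ≠ 0) : ∃ g : W.Hecke, A.hodge (W.translate g α) β ≠ 0 := by
  rw [G.algebraAction_eq_sum, map_sum, LinearMap.sum_apply] at h
  obtain ⟨g, -, hg⟩ := Finset.exists_ne_zero_of_sum_ne_zero h
  refine ⟨g, fun h0 => hg ?_⟩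
  simp only [map_smul, LinearMap.smul_apply, h0, smul_zero]

/-- The same on the right: if `α` pairs non-trivially with a Hecke-algebra translate of `β`, it pairs
non-trivially with a single translate of `β`. -/
theorem exists_pairing_ne_zero_of_algebra_right (y : MonoidAlgebra ℂ W.Hecke) (α β : Form)
    (h : A.hodge α (G.algebraAction y β) ≠ 0) : ∃ g : W.Hecke, A.hodge α (W.translate g β) ≠ 0 := by
  rw [G.algebraAction_eq_sum, map_sum] at h
  obtain ⟨g, -, hg⟩ := Finset.exists_ne_zero_of_sum_ne_zero h
  refine ⟨g, fun h0 => hg ?_⟩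
  simp only [map_smulₛₗ, h0, smul_zero]

include G in
/-- A joint translate of the two corner forms of a torus is the pull-back of their wedge:
`g^*ω_{2i} ∧ g^*ω_{2i+1} = g^*(ω_{2i} ∧ ω_{2i+1})`. -/
theorem pullOmegaS_joint (g h : W.Hecke) :
    W.pullOmegaS (![g, g, h, h]) = W.translate g (A.wedge (W.omega 0) (W.omega 1)) := by
  show A.wedge (W.translate g (W.omega 0)) (W.translate g (W.omega 1)) = _
  rw [G.translate_eq, G.translate_eq, G.translate_eq, G.wedge_comm]

include G in
/-- The same for the second torus. -/
theorem pullOmegaSbar_joint (g h : W.Hecke) :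
    W.pullOmegaSbar (![g, g, h, h]) = W.translate h (A.wedge (W.omega 2) (W.omega 3)) := by
  show A.wedge (W.translate h (W.omega 2)) (W.translate h (W.omega 3)) = _
  rw [G.translate_eq, G.translate_eq, G.translate_eq, G.wedge_comm]

/-- **(P) from a Hecke-algebra pairing of the two wedges**: if some elements `x, y` of the Hecke algebra make
`⟨x • (ω_0 ∧ ω_1), y • (ω_2 ∧ ω_3)⟩ ≠ 0`, then some choice of translates `γ = (g, g, h, h)` makes
`⟨f^*Ω_s, f^*Ω_{s̄}⟩ ≠ 0` — the sentence (P). -/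
theorem P_of_algebra_pairing (x y : MonoidAlgebra ℂ W.Hecke)
    (h : A.hodge (G.algebraAction x (A.wedge (W.omega 0) (W.omega 1)))
      (G.algebraAction y (A.wedge (W.omega 2) (W.omega 3))) ≠ 0) : W.P := by
  obtain ⟨g, hg⟩ := G.exists_pairing_ne_zero_of_algebra x _ _ h
  obtain ⟨k, hk⟩ := G.exists_pairing_ne_zero_of_algebra_right y _ _ hg
  refine ⟨![g, g, k, k], ?_⟩
  unfold Witness.hodgePairing
  rw [pullOmegaS_joint G, pullOmegaSbar_joint G]
  exact hk

/-- **(P) from a Hecke-algebra pairing, one-sided**: `⟨x • (ω_0 ∧ ω_1), ω_2 ∧ ω_3⟩ ≠ 0` for some `x ∈ ℂ[H]`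
(the shape of the isolation lemma `HodgeRepro.T3P1.exists_smul_pairing_ne_zero`) gives (P) with
`γ = (g, g, 1, 1)`. -/
theorem P_of_algebra_pairing_left (x : MonoidAlgebra ℂ W.Hecke)
    (h : A.hodge (G.algebraAction x (A.wedge (W.omega 0) (W.omega 1))) (A.wedge (W.omega 2) (W.omega 3)) ≠ 0) :
    W.P := by
  refine G.P_of_algebra_pairing x (single 1 1) ?_
  rwa [G.algebraAction_single, one_smul, G.translate_eq, map_one, Module.End.one_apply]

end HeckeGroup

end Summit.Ventures.HodgeRepro.Tier4.Common

end
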